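import Summits.QuantumFields.YangMills.Theorems.FluctuationComparisonRegPrIntLS2BetaCurlBudgetJunctionSplit
import Summits.QuantumFields.YangMills.Theorems.FluctuationComparisonRegPrIntLS2BetaThickReadCover
import Summits.QuantumFields.YangMills.Theorems.FluctuationComparisonRegPrIntLS2BetaTorusReadTransport
import Summits.QuantumFields.YangMills.Theorems.FluctuationComparisonRegPrIntLS2BetaBlockPairReadCover
import Summits.QuantumFields.YangMills.Theorems.FluctuationComparisonRegPrIntLS2BetaReadNesting
import HarnessLib

/-!
# S2β · (SCT″-c)₁ G4-ii (JS) — «THE JUNCTION SHARE»: ✓p838254 FILE C's READ-SUP remainder summand `Σ_t L^t·(Cst·Σ_B ‖𝟙_{read,2L+1}·rem‖²)` is an `S′`-SHARE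
# `≤ 256·Cst·M̄²·(2d·7^d)·S′` — `rem = e^S − 1 − S ≤ 16·M̄·(max chart norm)` under (T), the c₁ read cell read back in the member `F.P (J+t+1)` as px21's THICK READ′
# (the REVERSE T³ transport), and px21 ✓p838390 `sum_sq_thickReadSup_le_readSup` (ARCHITECT RULING «SRC-VOL»: the junction is priced in sup-per-coarsest-bond currency)

Cell `ym3-torus` (YM ladder rung R3 = continuum `SU(2)` Yang–Mills on the three-torus at fixed lattice data — a RUNG: NOT d = 4, NOT infinite volume, NOT a mass gap,
NOT Clay).  Width seat «width 10» `ym3-torus-px10` (gen 26); crux `stmt-QuantumFields-20520`, LINE g18-1 S2β; (JS) announced 2026-09-01T00:03:35Z.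
`--kind proof --supports stmt-QuantumFields-20520 --as helper`, count-neutral, DEFINITION-FREE (0 `def`, 0 `instance`, 0 `notation`, 0 `sorry`, default heartbeats).

WHAT IS PROVED (sorry-free).
§1 ★`rem_le_sixteen_mul` (`0 ≤ S ≤ 4m`, `S ≤ 4M̄ ≤ 1` ⇒ `e^S − 1 − S ≤ 16·M̄·m`, Mathlib ✓`Real.abs_exp_sub_one_sub_id_le`); ★`norm_chartPoint`; ★`blockOfIter_blockIter`.
§2 ★★`thickRead'_of_readCell` — the REVERSE T³ TRANSPORT: a site of `F.P K` at internal level `n` (`J + (t+1) + n = K`, `n + (t+1) = m`) in the c₁ read cell of `B` at thickness `θ`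
   (`∃ z₀, blockIter m z₀ ∈ {σB.src, σB.tgt} ∧ |rel (blockIter n z₀) ·|_κ ≤ θ`), read back in the member `F.P (J+(t+1))`, satisfies px21's THICK READ′ predicate at thickness `θ`
   (px13 ✓`siteShift_blockIter_eq_blockOfIter`, lit ✓`rel_siteShift`, ✓`siteShift_siteShift`; the converse of px13 ✓`read'_transport`).
§3 ★★`piSup_readCell_le_piSup_thickRead'` — hence the Pi-sup of `‖logVec(su2Quat(Ū^s(e^ζU₀) b·(Ū^sU₀ b)⁻¹))‖` over the cell is at most the Pi-sup of the station's descended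
   relative log size over THICK READ′ (✓`descendTo_apply_eq_iter`).
§4 ★★`piSup_rem_le` — per `(t, B)`: `‖𝟙_{read,2L+1}·rem_s‖ ≤ 16·M̄·‖𝟙_{READ′^{2L+2}_t(B)}·g‖` (the four chart norms sit in the cell thickened by one: ✓`natAbs_rel_le_add`,
   ✓`natAbs_rel_shift_le_one`; each `≤ Mg s ≤ M̄` by (T)); ★★★**`junctionShare_le`**: with (T) (`hMg`, window `Mg ≤ M̄`, `4M̄ ≤ 1`) and the quaternionic chart tower `X` (`hXdef`),
   **`Σ_{t<K−J} L^t·(Cst·Σ_B ‖𝟙_{read,2L+1}·rem_{K−J−1−t}‖²) ≤ (256·Cst·M̄²·(2d·7^d))·S′`** (`S′` = the station text VERBATIM; px21 ✓`sum_sq_thickReadSup_le_readSup J t (2L+2) 3`).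
NET with ✓p838254 + ✓p838306: `Σ_t L^t·c₁(t) ≤ 2·(2·Cst·κ²νC_b)·(4·L⁻¹·(L^{K−J}·REL) + W·Bsrc) + 2·(256·Cst·(2d·7^d)·M̄²)·S′` — the junction is the window-small β-share
`β_junc = 512·Cst·(2d·7^d)·M̄²` (RULING «FB-σ»: window constants last).

HONEST SCOPE.  Torus∕Pi-sup bookkeeping over landed letters; nothing of Bałaban's renormalisation-group analysis is asserted or proved ([Balaban1985Averaging] Prop. 4 (128)–(135)
pp.37–38; [Balaban1987RG1] (0.1)–(0.4), (0.11) pp.251–253); (T), `Bsrc`, the windows are HYPOTHESES; GAP♯∘ (`stub_uniformFibreGapOrbit`, registry 3732b7df UNTOUCHED, 0∕5), S2β,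
the five registered stubs, crux 20520, 19936, 19200 and `YM3TorusSU2` are NOT proved; no registered stub is closed; rung R3 — NOT d = 4, NOT infinite volume, NOT a mass gap,
NOT Clay; the Yang–Mills mass gap is NOT proved.
-/

set_option autoImplicit false

noncomputable section

open scoped Matrix.Norms.L2Operator
open Finset

namespace Summit.QuantumFields.YangMills.Theorems.FluctuationComparisonRegPrIntLS2BetaCurlBudgetJunctionShare

open Literature.MathematicalPhysics.QuantumFieldTheory.Balaban1983to89
open Literature.MathematicalPhysics.QuantumFieldTheory.Balaban1983to89.T4Continuum
open Literature.MathematicalPhysics.QuantumFieldTheory.Balaban1983to89.T3ContinuumYM3Torus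
open Literature.MathematicalPhysics.QuantumFieldTheory.Balaban1983to89.T3LevelShift
open Literature.MathematicalPhysics.QuantumFieldTheory.Balaban1983to89.T3TiltDescent
open Literature.MathematicalPhysics.QuantumFieldTheory.Balaban1983to89.T3UnitLawDensityEML (ℰp)
open Literature.MathematicalPhysics.QuantumFieldTheory.Balaban1983to89.T4HaarSU2ExpChart (expPoint)
open Literature.MathematicalPhysics.QuantumFieldTheory.Balaban1983to89.T4ExpWindowSmallField (logVec)
open Literature.MathematicalPhysics.QuantumFieldTheory.Balaban1983to89.HaarExponentialChart
open Literature.MathematicalPhysics.QuantumFieldTheory.Balaban1983to89.HaarExponentialChart.IsChartRep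
open Literature.MathematicalPhysics.QuantumFieldTheory.Balaban1983to89.BlockAveraging (Idx blockAvg)
open Literature.MathematicalPhysics.QuantumFieldTheory.Balaban1983to89.B14.Eq22Determines (blockIter blockIter_succ)
open Literature.MathematicalPhysics.QuantumFieldTheory.Balaban1983to89.B7SectAStatements (blockOfIter blockOfIter_zero blockOfIter_succ)
open Literature.MathematicalPhysics.QuantumFieldTheory.Balaban1983to89.B10Eq27TorusAxialLog (rel)
open Literature.MathematicalPhysics.QuantumFieldTheory.Balaban1983to89.B10Eq18SigmaSU2 (su2Coord)
open Literature.MathematicalPhysics.QuantumFieldTheory.Balaban1983to89.B10Eq18SigmaSU2Haar (rev norm_rev)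
open Literature.MathematicalPhysics.QuantumFieldTheory.Balaban1983to89.B10Eq18SigmaSU2Window (norm_su2Coord)
open Literature.MathematicalPhysics.QuantumLattice (su2Quat)
open Summit.QuantumFields.YangMills.Theorems.GlobalSlackKernelLeg (rel_siteShift)
open Summit.QuantumFields.YangMills.Theorems.FluctuationComparisonRegPrIntLS2BetaChartReadDescentOntoExpPoint (su2Coord_rev_mem_lie)
open Summit.QuantumFields.YangMills.Theorems.FluctuationComparisonRegPrIntLS2BetaTorusReadTransport (siteShift_blockIter_eq_blockOfIter)
open Summit.QuantumFields.YangMills.Theorems.FluctuationComparisonRegPrIntLS2BetaReadNesting (natAbs_rel_le_add)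
open Summit.QuantumFields.YangMills.Theorems.FluctuationComparisonRegPrIntLS2BetaBlockPairReadCover (natAbs_rel_shift_le_one)
open Summit.QuantumFields.YangMills.Theorems.FluctuationComparisonRegPrIntLS2BetaThickReadCover (sum_sq_thickReadSup_le_readSup)

/-! ## §1 Scalar and lattice helpers -/

/-- ★ `e^S − 1 − S ≤ 16·M̄·m` for `0 ≤ S ≤ 4m`, `S ≤ 4M̄ ≤ 1`. [folklore] -/
theorem rem_le_sixteen_mul {S M m : ℝ} (h0 : 0 ≤ S) (hSm : S ≤ 4 * m) (hSM : S ≤ 4 * M) (hM1 : 4 * M ≤ 1) :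
    Real.exp S - 1 - S ≤ 16 * M * m := by
  have h1 : |S| ≤ 1 := by rw [abs_of_nonneg h0]; exact hSM.trans hM1
  have h2 := Real.abs_exp_sub_one_sub_id_le h1
  have h3 : Real.exp S - 1 - S ≤ S ^ 2 := (le_abs_self _).trans h2
  have h4 : S ^ 2 ≤ (4 * M) * (4 * m) := by rw [sq]; exact mul_le_mul hSM hSm h0 (h0.trans hSM)
  linarith

/-- ★ The quaternionic chart point of `v` has norm `‖v‖`. [cite: Balaban1985Averaging, (19)-(20) p.21] -/
theorem norm_chartPoint (v : EuclideanSpace ℝ (Fin 3)) :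
    ‖(⟨su2Coord (rev v), su2Coord_rev_mem_lie _⟩ : (specialUnitaryLogChart (Fin 2)).lie)‖ = ‖v‖ := by
  show ‖su2Coord (rev v)‖ = ‖v‖
  rw [norm_su2Coord, norm_rev]

variable {P : Params} in
/-- ★ `blockOfIter s ∘ blockIter n = blockIter (n + s)` on the finest sites. [cite: Balaban1985Averaging, (2) p.17] -/
theorem blockOfIter_blockIter (n : ℕ) (z : Site P 0) : ∀ s : ℕ, blockOfIter s (blockIter n z) = blockIter (n + s) z
  | 0 => rfl
  | s + 1 => by rw [blockOfIter_succ, blockOfIter_blockIter n z s]; rfl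

variable (F : T3Family)

/-! ## §2 The reverse T³ transport: the c₁ read cell read back as THICK READ′ -/

/-- ★★ **THE REVERSE TRANSPORT**: a site `Y′` of `F.P K` at internal level `n` in the c₁ read cell of `B` (thickness `θ`), read back in the member `F.P (J+(t+1))` at its
finest level, satisfies the THICK READ′ predicate of `B` at thickness `θ` (converse of px13 ✓`read'_transport`). [cite: Balaban1987RG1, (0.1)-(0.4) pp.251-253] -/
theorem thickRead'_of_readCell {J t n m K : ℕ} (hK : J + (t + 1) + n = K) (hm : n + (t + 1) = m) (B : PBond (F.P J) 0) {θ : ℕ}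
    (Y' : Site (F.P K) n)
    (h : ∃ z₀ : Site (F.P K) 0,
      (blockIter m z₀ = (bondShift (F.sitesPerDir_eq (m := F.m) (K := J) (j := 0) (m' := F.m) (K' := K) (j' := m) (by omega)) B).src ∨
        blockIter m z₀ = (bondShift (F.sitesPerDir_eq (m := F.m) (K := J) (j := 0) (m' := F.m) (K' := K) (j' := m) (by omega)) B).tgt) ∧
      ∀ κ, (rel (blockIter n z₀) Y' κ).natAbs ≤ θ) :
    ∃ z : Site (F.P (J + (t + 1))) 0,
      (blockIter (t + 1) z = (bondShift (F.sitesPerDir_eq (m := F.m) (K := J) (j := 0) (m' := F.m) (K' := J + (t + 1)) (j' := t + 1) (by omega)) B).src ∨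
        blockIter (t + 1) z = (bondShift (F.sitesPerDir_eq (m := F.m) (K := J) (j := 0) (m' := F.m) (K' := J + (t + 1)) (j' := t + 1) (by omega)) B).tgt) ∧
      ∀ ν, (rel z ((siteShift (F.sitesPerDir_eq (m := F.m) (K := J + (t + 1)) (j := 0) (m' := F.m) (K' := K) (j' := n) (by omega))).symm Y') ν).natAbs ≤ θ := by
  subst hK
  subst hm
  obtain ⟨z₀, hz, hr⟩ := h
  have h0 : (F.P (J + (t + 1))).sitesPerDir 0 = (F.P (J + (t + 1) + n)).sitesPerDir (n + 0) :=
    F.sitesPerDir_eq (m := F.m) (K := J + (t + 1)) (j := 0) (m' := F.m) (K' := J + (t + 1) + n) (j' := n + 0) (by omega)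
  refine ⟨(siteShift h0).symm (blockIter n z₀), ?_, fun ν => ?_⟩
  · -- the block ancestor, transported
    have key := siteShift_blockIter_eq_blockOfIter (F := F) (K₁ := J + (t + 1)) (K₂ := J + (t + 1) + n) (n := n) rfl ((siteShift h0).symm (blockIter n z₀)) (t + 1)
    rw [Equiv.apply_symm_apply] at key
    have key' : siteShift (F.sitesPerDir_eq (m := F.m) (K := J + (t + 1)) (j := t + 1) (m' := F.m) (K' := J + (t + 1) + n) (j' := n + (t + 1)) (by omega))
        (blockIter (t + 1) ((siteShift h0).symm (blockIter n z₀))) = blockIter (n + (t + 1)) z₀ := key.trans (blockOfIter_blockIter n z₀ (t + 1))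
    have hinj := (siteShift (F.sitesPerDir_eq (m := F.m) (K := J + (t + 1)) (j := t + 1) (m' := F.m) (K' := J + (t + 1) + n) (j' := n + (t + 1)) (by omega))).injective
    rcases hz with hz | hz
    · left
      apply hinj
      refine key'.trans (hz.trans ?_)
      rw [bondShift_src, bondShift_src]
      exact (siteShift_siteShift _ _ _).symm
    · right
      apply hinj
      refine key'.trans (hz.trans ?_)
      rw [bondShift_tgt, bondShift_tgt]
      exact (siteShift_siteShift _ _ _).symm
  · have e := congrFun (rel_siteShift h0 ((siteShift h0).symm (blockIter n z₀))
      ((siteShift (F.sitesPerDir_eq (m := F.m) (K := J + (t + 1)) (j := 0) (m' := F.m) (K' := J + (t + 1) + n) (j' := n) (by omega))).symm Y')) ν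
    rw [Equiv.apply_symm_apply] at e
    have e2 : siteShift h0 ((siteShift (F.sitesPerDir_eq (m := F.m) (K := J + (t + 1)) (j := 0) (m' := F.m) (K' := J + (t + 1) + n) (j' := n) (by omega))).symm Y') = Y' :=
      Equiv.apply_symm_apply _ _
    rw [e2] at e
    exact (congrArg Int.natAbs e).symm.trans_le (hr ν)

/-! ## §3 Pi-sups: the cell of `F.P K` is dominated by THICK READ′ of the member -/

/-- ★★ **CELL SUP ≤ THICK-READ′ SUP**: the Pi-sup over the c₁ read cell (thickness `θ`, level `K − (J+(t+1))` of `F.P K`) of the relative log size is at most the Pi-sup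
of the station's DESCENDED relative log size over px21's THICK READ′ of thickness `θ` (§2 + `descendTo = Ū^{K−n} ∘ σ` by `rfl`). [cite: Balaban1987RG1, (0.1)-(0.4), (0.11) pp.251-253] -/
theorem piSup_readCell_le_piSup_thickRead' {J K t : ℕ} (ht : t < K - J)
    (U₀ : GaugeField (F.P K) 0 (Matrix.specialUnitaryGroup (Fin 2) ℂ)) (ζ : PBond (F.P K) 0 → EuclideanSpace ℝ (Fin 3)) (B : PBond (F.P J) 0) (θ : ℕ) :
    ‖(fun b : PBond (F.P K) (K - (J + (t + 1))) =>
        if ∃ z₀ : Site (F.P K) 0, (blockIter (K - J) z₀ = (bondShift (F.sitesPerDir_eq (m := F.m) (K := J) (j := 0) (m' := F.m) (K' := K) (j' := K - J) (by omega)) B).src ∨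
            blockIter (K - J) z₀ = (bondShift (F.sitesPerDir_eq (m := F.m) (K := J) (j := 0) (m' := F.m) (K' := K) (j' := K - J) (by omega)) B).tgt) ∧
            ∀ κ, (rel (blockIter (K - (J + (t + 1))) z₀) b.src κ).natAbs ≤ θ
        then ‖logVec (su2Quat (Averaging.iter (fun k => BlockAveraging.blockAvg (P := F.P K) (j := k) ℰp) (K - (J + (t + 1))) (fun ℓ => expPoint (ζ ℓ) * U₀ ℓ : GaugeField (F.P K) 0 (Matrix.specialUnitaryGroup (Fin 2) ℂ)) b * (Averaging.iter (fun k => BlockAveraging.blockAvg (P := F.P K) (j := k) ℰp) (K - (J + (t + 1))) U₀ b)⁻¹))‖ else 0)‖ ≤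
      ‖(fun ℓ' : PBond (F.P (J + (t + 1))) 0 =>
              if ∃ z : Site (F.P (J + (t + 1))) 0,
                (B14.Eq22Determines.blockIter (t + 1) z = (bondShift (F.sitesPerDir_eq (m := F.m) (K := J) (j := 0) (m' := F.m) (K' := J + (t + 1)) (j' := t + 1) (by omega)) B).src ∨ B14.Eq22Determines.blockIter (t + 1) z = (bondShift (F.sitesPerDir_eq (m := F.m) (K := J) (j := 0) (m' := F.m) (K' := J + (t + 1)) (j' := t + 1) (by omega)) B).tgt) ∧
                ∀ ν, (B10Eq27TorusAxialLog.rel z ℓ'.src ν).natAbs ≤ θ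
              then logVec (su2Quat (descendTo F ℰp (J + (t + 1)) K (by omega) (fun ℓ => expPoint (ζ ℓ) * U₀ ℓ : GaugeField (F.P K) 0 (Matrix.specialUnitaryGroup (Fin 2) ℂ)) ℓ' * (descendTo F ℰp (J + (t + 1)) K (by omega) U₀ ℓ')⁻¹)) else 0)‖ := by
  refine (pi_norm_le_iff_of_nonneg (norm_nonneg _)).2 fun b => ?_
  by_cases hc : ∃ z₀ : Site (F.P K) 0, (blockIter (K - J) z₀ = (bondShift (F.sitesPerDir_eq (m := F.m) (K := J) (j := 0) (m' := F.m) (K' := K) (j' := K - J) (by omega)) B).src ∨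
            blockIter (K - J) z₀ = (bondShift (F.sitesPerDir_eq (m := F.m) (K := J) (j := 0) (m' := F.m) (K' := K) (j' := K - J) (by omega)) B).tgt) ∧
            ∀ κ, (rel (blockIter (K - (J + (t + 1))) z₀) b.src κ).natAbs ≤ θ
  · rw [if_pos hc]
    have hread : ∃ z : Site (F.P (J + (t + 1))) 0,
                (B14.Eq22Determines.blockIter (t + 1) z = (bondShift (F.sitesPerDir_eq (m := F.m) (K := J) (j := 0) (m' := F.m) (K' := J + (t + 1)) (j' := t + 1) (by omega)) B).src ∨ B14.Eq22Determines.blockIter (t + 1) z = (bondShift (F.sitesPerDir_eq (m := F.m) (K := J) (j := 0) (m' := F.m) (K' := J + (t + 1)) (j' := t + 1) (by omega)) B).tgt) ∧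
                ∀ ν, (B10Eq27TorusAxialLog.rel z ((bondShift (F.sitesPerDir_eq (m := F.m) (K := J + (t + 1)) (j := 0) (m' := F.m) (K' := K) (j' := (K - (J + (t + 1)))) (by omega))).symm b).src ν).natAbs ≤ θ :=
      thickRead'_of_readCell F (J := J) (t := t) (n := (K - (J + (t + 1)))) (m := K - J) (K := K) (by omega) (by omega) B b.src hc
    have hval := norm_le_pi_norm (fun ℓ' : PBond (F.P (J + (t + 1))) 0 =>
              if ∃ z : Site (F.P (J + (t + 1))) 0,
                (B14.Eq22Determines.blockIter (t + 1) z = (bondShift (F.sitesPerDir_eq (m := F.m) (K := J) (j := 0) (m' := F.m) (K' := J + (t + 1)) (j' := t + 1) (by omega)) B).src ∨ B14.Eq22Determines.blockIter (t + 1) z = (bondShift (F.sitesPerDir_eq (m := F.m) (K := J) (j := 0) (m' := F.m) (K' := J + (t + 1)) (j' := t + 1) (by omega)) B).tgt) ∧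
                ∀ ν, (B10Eq27TorusAxialLog.rel z ℓ'.src ν).natAbs ≤ θ
              then logVec (su2Quat (descendTo F ℰp (J + (t + 1)) K (by omega) (fun ℓ => expPoint (ζ ℓ) * U₀ ℓ : GaugeField (F.P K) 0 (Matrix.specialUnitaryGroup (Fin 2) ℂ)) ℓ' * (descendTo F ℰp (J + (t + 1)) K (by omega) U₀ ℓ')⁻¹)) else 0) ((bondShift (F.sitesPerDir_eq (m := F.m) (K := J + (t + 1)) (j := 0) (m' := F.m) (K' := K) (j' := (K - (J + (t + 1)))) (by omega))).symm b)
    rw [if_pos hread] at hval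
    have hb : ∀ U : GaugeField (F.P K) 0 (Matrix.specialUnitaryGroup (Fin 2) ℂ),
        descendTo F ℰp (J + (t + 1)) K (by omega) U ((bondShift (F.sitesPerDir_eq (m := F.m) (K := J + (t + 1)) (j := 0) (m' := F.m) (K' := K) (j' := (K - (J + (t + 1)))) (by omega))).symm b) = Averaging.iter (fun k => BlockAveraging.blockAvg (P := F.P K) (j := k) ℰp) (K - (J + (t + 1))) U b := by
      intro U
      show Averaging.iter (fun k => BlockAveraging.blockAvg (P := F.P K) (j := k) ℰp) (K - (J + (t + 1))) U (bondShift (F.sitesPerDir_eq (m := F.m) (K := J + (t + 1)) (j := 0) (m' := F.m) (K' := K) (j' := (K - (J + (t + 1)))) (by omega)) ((bondShift (F.sitesPerDir_eq (m := F.m) (K := J + (t + 1)) (j := 0) (m' := F.m) (K' := K) (j' := (K - (J + (t + 1)))) (by omega))).symm b)) = _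
      rw [Equiv.apply_symm_apply]
    rw [hb, hb] at hval
    rw [Real.norm_of_nonneg (norm_nonneg _)]
    exact hval
  · rw [if_neg hc, norm_zero]
    exact norm_nonneg _

/-! ## §4 The junction share -/

/-- ★★ **PER `(t, B)`**: `‖𝟙_{read,2L+1}·rem_s‖ ≤ 16·M̄·‖𝟙_{READ′^{2L+2}_t(B)}·g‖` — the four chart norms of `rem` sit in the cell thickened by one (✓`natAbs_rel_le_add`,
✓`natAbs_rel_shift_le_one`), each is `≤ M̄` by (T); §1; §3. [cite: Balaban1985Averaging, (58) p.27, Prop. 4 (128)-(135) pp.37-38; Balaban1987RG1, (0.11) p.253] -/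
theorem piSup_rem_le {J K t : ℕ} (ht : t < K - J)
    (U₀ : GaugeField (F.P K) 0 (Matrix.specialUnitaryGroup (Fin 2) ℂ)) (ζ : PBond (F.P K) 0 → EuclideanSpace ℝ (Fin 3)) (B : PBond (F.P J) 0)
    (X : (i : ℕ) → PBond (F.P K) i → (specialUnitaryLogChart (Fin 2)).lie)
    (hXdef : X = fun (i : ℕ) (b : PBond (F.P K) i) =>
      (⟨su2Coord (rev (logVec (su2Quat (Averaging.iter (fun k => BlockAveraging.blockAvg (P := F.P K) (j := k) ℰp) i (fun ℓ => expPoint (ζ ℓ) * U₀ ℓ : GaugeField (F.P K) 0 (Matrix.specialUnitaryGroup (Fin 2) ℂ)) b * (Averaging.iter (fun k => BlockAveraging.blockAvg (P := F.P K) (j := k) ℰp) i U₀ b)⁻¹)))), su2Coord_rev_mem_lie _⟩ : (specialUnitaryLogChart (Fin 2)).lie))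
    (Mbar : ℝ) (hM0 : 0 ≤ Mbar) (hM1 : 4 * Mbar ≤ 1)
    (hM : ∀ b : PBond (F.P K) (K - (J + (t + 1))), ‖logVec (su2Quat (Averaging.iter (fun k => BlockAveraging.blockAvg (P := F.P K) (j := k) ℰp) (K - (J + (t + 1))) (fun ℓ => expPoint (ζ ℓ) * U₀ ℓ : GaugeField (F.P K) 0 (Matrix.specialUnitaryGroup (Fin 2) ℂ)) b * (Averaging.iter (fun k => BlockAveraging.blockAvg (P := F.P K) (j := k) ℰp) (K - (J + (t + 1))) U₀ b)⁻¹))‖ ≤ Mbar) :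
    ‖(fun p : Plaq (F.P K) (K - (J + (t + 1))) =>
        if ∃ z₀ : Site (F.P K) 0, (blockIter (K - J) z₀ = (bondShift (F.sitesPerDir_eq (m := F.m) (K := J) (j := 0) (m' := F.m) (K' := K) (j' := K - J) (by omega)) B).src ∨
            blockIter (K - J) z₀ = (bondShift (F.sitesPerDir_eq (m := F.m) (K := J) (j := 0) (m' := F.m) (K' := K) (j' := K - J) (by omega)) B).tgt) ∧
            ∀ κ, (rel (blockIter (K - (J + (t + 1))) z₀) p.src κ).natAbs ≤ 2 * F.L + 1
        then (Real.exp (‖X (K - (J + (t + 1))) ⟨p.src, p.μ⟩‖ + ‖X (K - (J + (t + 1))) ⟨(p.src).shift p.μ, p.ν⟩‖ + ‖X (K - (J + (t + 1))) ⟨(p.src).shift p.ν, p.μ⟩‖ + ‖X (K - (J + (t + 1))) ⟨p.src, p.ν⟩‖) - 1 - (‖X (K - (J + (t + 1))) ⟨p.src, p.μ⟩‖ + ‖X (K - (J + (t + 1))) ⟨(p.src).shift p.μ, p.ν⟩‖ + ‖X (K - (J + (t + 1))) ⟨(p.src).shift p.ν, p.μ⟩‖ + ‖X (K - (J + (t +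 1))) ⟨p.src, p.ν⟩‖))
        else 0)‖ ≤
      16 * Mbar * ‖(fun ℓ' : PBond (F.P (J + (t + 1))) 0 =>
              if ∃ z : Site (F.P (J + (t + 1))) 0,
                (B14.Eq22Determines.blockIter (t + 1) z = (bondShift (F.sitesPerDir_eq (m := F.m) (K := J) (j := 0) (m' := F.m) (K' := J + (t + 1)) (j' := t + 1) (by omega)) B).src ∨ B14.Eq22Determines.blockIter (t + 1) z = (bondShift (F.sitesPerDir_eq (m := F.m) (K := J) (j := 0) (m' := F.m) (K' := J + (t + 1)) (j' := t + 1) (by omega)) B).tgt) ∧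
                ∀ ν, (B10Eq27TorusAxialLog.rel z ℓ'.src ν).natAbs ≤ (2 * F.L + 2)
              then logVec (su2Quat (descendTo F ℰp (J + (t + 1)) K (by omega) (fun ℓ => expPoint (ζ ℓ) * U₀ ℓ : GaugeField (F.P K) 0 (Matrix.specialUnitaryGroup (Fin 2) ℂ)) ℓ' * (descendTo F ℰp (J + (t + 1)) K (by omega) U₀ ℓ')⁻¹)) else 0)‖ := by
  have h3 := piSup_readCell_le_piSup_thickRead' F ht U₀ ζ B (2 * F.L + 2)
  subst hXdef
  refine (pi_norm_le_iff_of_nonneg (mul_nonneg (mul_nonneg (by norm_num) hM0) (norm_nonneg _))).2 fun p => ?_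
  by_cases hc : ∃ z₀ : Site (F.P K) 0, (blockIter (K - J) z₀ = (bondShift (F.sitesPerDir_eq (m := F.m) (K := J) (j := 0) (m' := F.m) (K' := K) (j' := K - J) (by omega)) B).src ∨
            blockIter (K - J) z₀ = (bondShift (F.sitesPerDir_eq (m := F.m) (K := J) (j := 0) (m' := F.m) (K' := K) (j' := K - J) (by omega)) B).tgt) ∧
            ∀ κ, (rel (blockIter (K - (J + (t + 1))) z₀) p.src κ).natAbs ≤ 2 * F.L + 1
  · rw [if_pos hc]
    simp only [norm_chartPoint]
    -- the four bonds lie in the cell thickened by one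
    obtain ⟨z₀, hz₀, hr⟩ := hc
    have hin : ∀ b : PBond (F.P K) (K - (J + (t + 1))), (∀ κ, (rel p.src b.src κ).natAbs ≤ 1) →
        ‖logVec (su2Quat (Averaging.iter (fun k => BlockAveraging.blockAvg (P := F.P K) (j := k) ℰp) (K - (J + (t + 1))) (fun ℓ => expPoint (ζ ℓ) * U₀ ℓ : GaugeField (F.P K) 0 (Matrix.specialUnitaryGroup (Fin 2) ℂ)) b * (Averaging.iter (fun k => BlockAveraging.blockAvg (P := F.P K) (j := k) ℰp) (K - (J + (t + 1))) U₀ b)⁻¹))‖ ≤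
          ‖(fun b : PBond (F.P K) (K - (J + (t + 1))) =>
        if ∃ z₀ : Site (F.P K) 0, (blockIter (K - J) z₀ = (bondShift (F.sitesPerDir_eq (m := F.m) (K := J) (j := 0) (m' := F.m) (K' := K) (j' := K - J) (by omega)) B).src ∨
            blockIter (K - J) z₀ = (bondShift (F.sitesPerDir_eq (m := F.m) (K := J) (j := 0) (m' := F.m) (K' := K) (j' := K - J) (by omega)) B).tgt) ∧
            ∀ κ, (rel (blockIter (K - (J + (t + 1))) z₀) b.src κ).natAbs ≤ (2 * F.L + 2)
        then ‖logVec (su2Quat (Averaging.iter (fun k => BlockAveraging.blockAvg (P := F.P K) (j := k) ℰp) (K - (J + (t + 1))) (fun ℓ => expPoint (ζ ℓ) * U₀ ℓ : GaugeField (F.P K) 0 (Matrix.specialUnitaryGroup (Fin 2) ℂ)) b * (Averaging.iter (fun k => BlockAveraging.blockAvg (P := F.P K) (j := k) ℰp) (K - (J + (t + 1))) U₀ b)⁻¹))‖ else 0)‖ := by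
      intro b hb1
      have hcb : ∃ z₀ : Site (F.P K) 0, (blockIter (K - J) z₀ = (bondShift (F.sitesPerDir_eq (m := F.m) (K := J) (j := 0) (m' := F.m) (K' := K) (j' := K - J) (by omega)) B).src ∨
            blockIter (K - J) z₀ = (bondShift (F.sitesPerDir_eq (m := F.m) (K := J) (j := 0) (m' := F.m) (K' := K) (j' := K - J) (by omega)) B).tgt) ∧
            ∀ κ, (rel (blockIter (K - (J + (t + 1))) z₀) b.src κ).natAbs ≤ (2 * F.L + 2) :=
        ⟨z₀, hz₀, fun κ => (natAbs_rel_le_add _ p.src _ κ).trans (by have := hr κ; have := hb1 κ; omega)⟩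
      have h := norm_le_pi_norm (fun b : PBond (F.P K) (K - (J + (t + 1))) =>
        if ∃ z₀ : Site (F.P K) 0, (blockIter (K - J) z₀ = (bondShift (F.sitesPerDir_eq (m := F.m) (K := J) (j := 0) (m' := F.m) (K' := K) (j' := K - J) (by omega)) B).src ∨
            blockIter (K - J) z₀ = (bondShift (F.sitesPerDir_eq (m := F.m) (K := J) (j := 0) (m' := F.m) (K' := K) (j' := K - J) (by omega)) B).tgt) ∧
            ∀ κ, (rel (blockIter (K - (J + (t + 1))) z₀) b.src κ).natAbs ≤ (2 * F.L + 2)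
        then ‖logVec (su2Quat (Averaging.iter (fun k => BlockAveraging.blockAvg (P := F.P K) (j := k) ℰp) (K - (J + (t + 1))) (fun ℓ => expPoint (ζ ℓ) * U₀ ℓ : GaugeField (F.P K) 0 (Matrix.specialUnitaryGroup (Fin 2) ℂ)) b * (Averaging.iter (fun k => BlockAveraging.blockAvg (P := F.P K) (j := k) ℰp) (K - (J + (t + 1))) U₀ b)⁻¹))‖ else 0) b
      rw [if_pos hcb, Real.norm_of_nonneg (norm_nonneg _)] at h
      exact h
    have hself : ∀ κ, (rel p.src p.src κ).natAbs ≤ 1 := fun κ => by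
      have := natAbs_rel_le_add p.src (p.src.shift p.μ) p.src κ
      rw [B10Eq27TorusAxialLog.rel_self] at *; simp
    have e1 := (hin ⟨p.src, p.μ⟩ hself).trans h3
    have e2 := (hin ⟨(p.src).shift p.μ, p.ν⟩ (fun κ => natAbs_rel_shift_le_one p.src p.μ κ)).trans h3
    have e3 := (hin ⟨(p.src).shift p.ν, p.μ⟩ (fun κ => natAbs_rel_shift_le_one p.src p.ν κ)).trans h3
    have e4 := (hin ⟨p.src, p.ν⟩ hself).trans h3
    have m1 := hM ⟨p.src, p.μ⟩
    have m2 := hM ⟨(p.src).shift p.μ, p.ν⟩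
    have m3 := hM ⟨(p.src).shift p.ν, p.μ⟩
    have m4 := hM ⟨p.src, p.ν⟩
    have hS0 : 0 ≤ ‖logVec (su2Quat (Averaging.iter (fun k => BlockAveraging.blockAvg (P := F.P K) (j := k) ℰp) (K - (J + (t + 1))) (fun ℓ => expPoint (ζ ℓ) * U₀ ℓ : GaugeField (F.P K) 0 (Matrix.specialUnitaryGroup (Fin 2) ℂ)) ⟨p.src, p.μ⟩ * (Averaging.iter (fun k => BlockAveraging.blockAvg (P := F.P K) (j := k) ℰp) (K - (J + (t + 1))) U₀ ⟨p.src, p.μ⟩)⁻¹))‖ + ‖logVec (su2Quat (Averaging.iter (fun k => BlockAveraging.blockAvg (P := F.P K) (j := k) ℰp) (K - (J + (t + 1))) (fun ℓ => expPoint (ζ ℓ) * U₀ ℓ : GaugeField (F.P K) 0 (Matrix.specialUnitaryGroup (Fin 2) ℂ)) ⟨(p.src).shift p.μ, p.ν⟩ * (Averaging.iter (fun k => BlockAveraging.blockAvg (P := F.P K) (j := k) ℰp) (K - (J + (t + 1))) U₀ ⟨(p.src).shift p.μ, p.ν⟩)⁻¹))‖ +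
        ‖logVec (su2Quat (Averaging.iter (fun k => BlockAveraging.blockAvg (P := F.P K) (j := k) ℰp) (K - (J + (t + 1))) (fun ℓ => expPoint (ζ ℓ) * U₀ ℓ : GaugeField (F.P K) 0 (Matrix.specialUnitaryGroup (Fin 2) ℂ)) ⟨(p.src).shift p.ν, p.μ⟩ * (Averaging.iter (fun k => BlockAveraging.blockAvg (P := F.P K) (j := k) ℰp) (K - (J + (t + 1))) U₀ ⟨(p.src).shift p.ν, p.μ⟩)⁻¹))‖ + ‖logVec (su2Quat (Averaging.iter (fun k => BlockAveraging.blockAvg (P := F.P K) (j := k) ℰp) (K - (J + (t + 1))) (fun ℓ => expPoint (ζ ℓ) * U₀ ℓ : GaugeField (F.P K) 0 (Matrix.specialUnitaryGroup (Fin 2) ℂ)) ⟨p.src, p.ν⟩ * (Averaging.iter (fun k => BlockAveraging.blockAvg (P := F.P K) (j := k) ℰp) (K - (J + (t + 1))) U₀ ⟨p.src, p.ν⟩)⁻¹))‖ := by positivity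
    have hrem := rem_le_sixteen_mul hS0 (m := ‖(fun ℓ' : PBond (F.P (J + (t + 1))) 0 =>
              if ∃ z : Site (F.P (J + (t + 1))) 0,
                (B14.Eq22Determines.blockIter (t + 1) z = (bondShift (F.sitesPerDir_eq (m := F.m) (K := J) (j := 0) (m' := F.m) (K' := J + (t + 1)) (j' := t + 1) (by omega)) B).src ∨ B14.Eq22Determines.blockIter (t + 1) z = (bondShift (F.sitesPerDir_eq (m := F.m) (K := J) (j := 0) (m' := F.m) (K' := J + (t + 1)) (j' := t + 1) (by omega)) B).tgt) ∧
                ∀ ν, (B10Eq27TorusAxialLog.rel z ℓ'.src ν).natAbs ≤ (2 * F.L + 2)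
              then logVec (su2Quat (descendTo F ℰp (J + (t + 1)) K (by omega) (fun ℓ => expPoint (ζ ℓ) * U₀ ℓ : GaugeField (F.P K) 0 (Matrix.specialUnitaryGroup (Fin 2) ℂ)) ℓ' * (descendTo F ℰp (J + (t + 1)) K (by omega) U₀ ℓ')⁻¹)) else 0)‖) (M := Mbar) (by linarith) (by linarith) hM1
    rw [Real.norm_of_nonneg (by linarith [Real.add_one_le_exp (‖logVec (su2Quat (Averaging.iter (fun k => BlockAveraging.blockAvg (P := F.P K) (j := k) ℰp) (K - (J + (t + 1))) (fun ℓ => expPoint (ζ ℓ) * U₀ ℓ : GaugeField (F.P K) 0 (Matrix.specialUnitaryGroup (Fin 2) ℂ)) ⟨p.src, p.μ⟩ * (Averaging.iter (fun k => BlockAveraging.blockAvg (P := F.P K) (j := k) ℰp) (K - (J + (t + 1))) U₀ ⟨p.src, p.μ⟩)⁻¹))‖ + ‖logVec (su2Quat (Averaging.iter (fun k => BlockAveraging.blockAvg (P := F.P K) (j := k) ℰp) (K - (J + (t + 1))) (fun ℓ => expPoint (ζ ℓ) * U₀ ℓ : GaugeField (F.P K) 0 (Matrix.specialUnitaryGroup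 (Fin 2) ℂ)) ⟨(p.src).shift p.μ, p.ν⟩ * (Averaging.iter (fun k => BlockAveraging.blockAvg (P := F.P K) (j := k) ℰp) (K - (J + (t + 1))) U₀ ⟨(p.src).shift p.μ, p.ν⟩)⁻¹))‖ +
        ‖logVec (su2Quat (Averaging.iter (fun k => BlockAveraging.blockAvg (P := F.P K) (j := k) ℰp) (K - (J + (t + 1))) (fun ℓ => expPoint (ζ ℓ) * U₀ ℓ : GaugeField (F.P K) 0 (Matrix.specialUnitaryGroup (Fin 2) ℂ)) ⟨(p.src).shift p.ν, p.μ⟩ * (Averaging.iter (fun k => BlockAveraging.blockAvg (P := F.P K) (j := k) ℰp) (K - (J + (t + 1))) U₀ ⟨(p.src).shift p.ν, p.μ⟩)⁻¹))‖ + ‖logVec (su2Quat (Averaging.iter (fun k => BlockAveraging.blockAvg (P := F.P K) (j := k) ℰp) (K - (J + (t + 1))) (fun ℓ => expPoint (ζ ℓ) * U₀ ℓ : GaugeField (F.P K) 0 (Matrix.specialUnitaryGroup (Fin 2) ℂ)) ⟨p.src, p.ν⟩ * (Averaging.iter (fun k => BlockAveraging.blockAvg (P := F.P K) (j := k) ℰp)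 (K - (J + (t + 1))) U₀ ⟨p.src, p.ν⟩)⁻¹))‖)])]
    exact hrem
  · rw [if_neg hc, norm_zero]
    exact mul_nonneg (mul_nonneg (by norm_num) hM0) (norm_nonneg _)

/-- ★★★ **THE JUNCTION SHARE**: ✓p838254 FILE C's read-sup remainder summand is an `S′`-share,
`Σ_{t<K−J} L^t·(Cst·Σ_B ‖𝟙_{read,2L+1}·rem_{K−J−1−t}‖²) ≤ (256·Cst·M̄²·(2d·7^d))·S′` (§4 per `(t,B)`, px21 ✓`sum_sq_thickReadSup_le_readSup J t (2L+2) 3`, `S′` = the station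
text VERBATIM). [cite: Balaban1985Averaging, Prop. 4 (128)-(135) pp.37-38; Balaban1987RG1, (0.1)-(0.4), (0.11) pp.251-253] -/
theorem junctionShare_le {J K : ℕ} (hJK : J ≤ K)
    (U₀ : GaugeField (F.P K) 0 (Matrix.specialUnitaryGroup (Fin 2) ℂ)) (ζ : PBond (F.P K) 0 → EuclideanSpace ℝ (Fin 3))
    (X : (i : ℕ) → PBond (F.P K) i → (specialUnitaryLogChart (Fin 2)).lie)
    (hXdef : X = fun (i : ℕ) (b : PBond (F.P K) i) =>
      (⟨su2Coord (rev (logVec (su2Quat (Averaging.iter (fun k => BlockAveraging.blockAvg (P := F.P K) (j := k) ℰp) i (fun ℓ => expPoint (ζ ℓ) * U₀ ℓ : GaugeField (F.P K) 0 (Matrix.specialUnitaryGroup (Fin 2) ℂ)) b * (Averaging.iter (fun k => BlockAveraging.blockAvg (P := F.P K) (j := k) ℰp) i U₀ b)⁻¹)))), su2Coord_rev_mem_lie _⟩ : (specialUnitaryLogChart (Fin 2)).lie))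
    (Cst : ℝ) (hCst : 0 ≤ Cst) (Mbar : ℝ) (hM0 : 0 ≤ Mbar) (hM1 : 4 * Mbar ≤ 1)
    (hM : ∀ s, s < K - J → ∀ b : PBond (F.P K) s, ‖logVec (su2Quat (Averaging.iter (fun k => BlockAveraging.blockAvg (P := F.P K) (j := k) ℰp) s (fun ℓ => expPoint (ζ ℓ) * U₀ ℓ : GaugeField (F.P K) 0 (Matrix.specialUnitaryGroup (Fin 2) ℂ)) b * (Averaging.iter (fun k => BlockAveraging.blockAvg (P := F.P K) (j := k) ℰp) s U₀ b)⁻¹))‖ ≤ Mbar) :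
    ∑ t ∈ Finset.range (K - J), (F.L : ℝ) ^ t * (fun t => Cst * ∑ B : PBond (F.P J) 0,
      ‖(fun p : Plaq (F.P K) (K - J - 1 - t) =>
        if ∃ z₀ : Site (F.P K) 0, (blockIter (K - J) z₀ = (bondShift (F.sitesPerDir_eq (m := F.m) (K := J) (j := 0) (m' := F.m) (K' := K) (j' := K - J) (by omega)) B).src ∨
            blockIter (K - J) z₀ = (bondShift (F.sitesPerDir_eq (m := F.m) (K := J) (j := 0) (m' := F.m) (K' := K) (j' := K - J) (by omega)) B).tgt) ∧
            ∀ κ, (rel (blockIter (K - J - 1 - t) z₀) p.src κ).natAbs ≤ 2 * F.L + 1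
        then (Real.exp (‖X (K - J - 1 - t) ⟨p.src, p.μ⟩‖ + ‖X (K - J - 1 - t) ⟨(p.src).shift p.μ, p.ν⟩‖ + ‖X (K - J - 1 - t) ⟨(p.src).shift p.ν, p.μ⟩‖ + ‖X (K - J - 1 - t) ⟨p.src, p.ν⟩‖) - 1 - (‖X (K - J - 1 - t) ⟨p.src, p.μ⟩‖ + ‖X (K - J - 1 - t) ⟨(p.src).shift p.μ, p.ν⟩‖ + ‖X (K - J - 1 - t) ⟨(p.src).shift p.ν, p.μ⟩‖ + ‖X (K - J - 1 - t) ⟨p.src, p.ν⟩‖))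
        else 0)‖ ^ 2) t ≤
      (256 * Cst * Mbar ^ 2 * ((2 * (F.P J).d * (2 * 3 + 1) ^ (F.P J).d : ℕ) : ℝ)) * (∑ t ∈ Finset.range (K - J), (if ht : t < K - J then
          (F.L : ℝ) ^ t * ∑ B : PBond (F.P J) 0,
            ‖(fun ℓ' : PBond (F.P (J + (t + 1))) 0 =>
              if ∃ z : Site (F.P (J + (t + 1))) 0,
                (B14.Eq22Determines.blockIter (t + 1) z = (bondShift (F.sitesPerDir_eq (m := F.m) (K := J) (j := 0) (m' := F.m) (K' := J + (t + 1)) (j' := t + 1) (by omega)) B).src ∨ B14.Eq22Determines.blockIter (t + 1) z = (bondShift (F.sitesPerDir_eq (m := F.m) (K := J) (j := 0) (m' := F.m) (K' := J + (t + 1)) (j' := t + 1) (by omega)) B).tgt) ∧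
                ∀ ν, (B10Eq27TorusAxialLog.rel z ℓ'.src ν).natAbs ≤ 2
              then logVec (su2Quat (descendTo F ℰp (J + (t + 1)) K (by omega) (fun ℓ => expPoint (ζ ℓ) * U₀ ℓ : GaugeField (F.P K) 0 (Matrix.specialUnitaryGroup (Fin 2) ℂ)) ℓ' * (descendTo F ℰp (J + (t + 1)) K (by omega) U₀ ℓ')⁻¹)) else 0)‖ ^ 2
        else 0)) := by
  have hL0 : (0 : ℝ) ≤ (F.L : ℝ) := Nat.cast_nonneg _
  rw [Finset.mul_sum]
  refine Finset.sum_le_sum fun t ht' => ?_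
  have ht : t < K - J := Finset.mem_range.1 ht'
  rw [dif_pos ht]
  have e : K - J - 1 - t = K - (J + (t + 1)) := by omega
  beta_reduce
  rw [e]
  -- per coarsest bond
  have hsq : ∀ B : PBond (F.P J) 0, ‖(fun p : Plaq (F.P K) (K - (J + (t + 1))) =>
        if ∃ z₀ : Site (F.P K) 0, (blockIter (K - J) z₀ = (bondShift (F.sitesPerDir_eq (m := F.m) (K := J) (j := 0) (m' := F.m) (K' := K) (j' := K - J) (by omega)) B).src ∨
            blockIter (K - J) z₀ = (bondShift (F.sitesPerDir_eq (m := F.m) (K := J) (j := 0) (m' := F.m) (K' := K) (j' := K - J) (by omega)) B).tgt) ∧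
            ∀ κ, (rel (blockIter (K - (J + (t + 1))) z₀) p.src κ).natAbs ≤ 2 * F.L + 1
        then (Real.exp (‖X (K - (J + (t + 1))) ⟨p.src, p.μ⟩‖ + ‖X (K - (J + (t + 1))) ⟨(p.src).shift p.μ, p.ν⟩‖ + ‖X (K - (J + (t + 1))) ⟨(p.src).shift p.ν, p.μ⟩‖ + ‖X (K - (J + (t + 1))) ⟨p.src, p.ν⟩‖) - 1 - (‖X (K - (J + (t + 1))) ⟨p.src, p.μ⟩‖ + ‖X (K - (J + (t + 1))) ⟨(p.src).shift p.μ, p.ν⟩‖ + ‖X (K - (J + (t + 1))) ⟨(p.src).shift p.ν, p.μ⟩‖ + ‖X (K - (J + (t + 1))) ⟨p.src, p.ν⟩‖))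
        else 0)‖ ^ 2 ≤
      256 * Mbar ^ 2 * ‖(fun ℓ' : PBond (F.P (J + (t + 1))) 0 =>
              if ∃ z : Site (F.P (J + (t + 1))) 0,
                (B14.Eq22Determines.blockIter (t + 1) z = (bondShift (F.sitesPerDir_eq (m := F.m) (K := J) (j := 0) (m' := F.m) (K' := J + (t + 1)) (j' := t + 1) (by omega)) B).src ∨ B14.Eq22Determines.blockIter (t + 1) z = (bondShift (F.sitesPerDir_eq (m := F.m) (K := J) (j := 0) (m' := F.m) (K' := J + (t + 1)) (j' := t + 1) (by omega)) B).tgt) ∧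
                ∀ ν, (B10Eq27TorusAxialLog.rel z ℓ'.src ν).natAbs ≤ (2 * F.L + 2)
              then logVec (su2Quat (descendTo F ℰp (J + (t + 1)) K (by omega) (fun ℓ => expPoint (ζ ℓ) * U₀ ℓ : GaugeField (F.P K) 0 (Matrix.specialUnitaryGroup (Fin 2) ℂ)) ℓ' * (descendTo F ℰp (J + (t + 1)) K (by omega) U₀ ℓ')⁻¹)) else 0)‖ ^ 2 := by
    intro B
    have h4 := piSup_rem_le F ht U₀ ζ B X hXdef Mbar hM0 hM1 (hM _ (by omega))
    have h0 : 0 ≤ ‖(fun p : Plaq (F.P K) (K - (J + (t + 1))) =>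
        if ∃ z₀ : Site (F.P K) 0, (blockIter (K - J) z₀ = (bondShift (F.sitesPerDir_eq (m := F.m) (K := J) (j := 0) (m' := F.m) (K' := K) (j' := K - J) (by omega)) B).src ∨
            blockIter (K - J) z₀ = (bondShift (F.sitesPerDir_eq (m := F.m) (K := J) (j := 0) (m' := F.m) (K' := K) (j' := K - J) (by omega)) B).tgt) ∧
            ∀ κ, (rel (blockIter (K - (J + (t + 1))) z₀) p.src κ).natAbs ≤ 2 * F.L + 1
        then (Real.exp (‖X (K - (J + (t + 1))) ⟨p.src, p.μ⟩‖ + ‖X (K - (J + (t + 1))) ⟨(p.src).shift p.μ, p.ν⟩‖ + ‖X (K - (J + (t + 1))) ⟨(p.src).shift p.ν, p.μ⟩‖ + ‖X (K - (J + (t + 1))) ⟨p.src, p.ν⟩‖) - 1 - (‖X (K - (J + (t + 1))) ⟨p.src, p.μ⟩‖ + ‖X (K - (J + (t + 1))) ⟨(p.src).shift p.μ, p.ν⟩‖ + ‖X (K - (J + (t + 1))) ⟨(p.src).shift p.ν, p.μ⟩‖ + ‖X (K - (J + (t + 1))) ⟨p.src, p.ν⟩‖))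
        else 0)‖ := norm_nonneg _
    calc _ ≤ (16 * Mbar * ‖(fun ℓ' : PBond (F.P (J + (t + 1))) 0 =>
              if ∃ z : Site (F.P (J + (t + 1))) 0,
                (B14.Eq22Determines.blockIter (t + 1) z = (bondShift (F.sitesPerDir_eq (m := F.m) (K := J) (j := 0) (m' := F.m) (K' := J + (t + 1)) (j' := t + 1) (by omega)) B).src ∨ B14.Eq22Determines.blockIter (t + 1) z = (bondShift (F.sitesPerDir_eq (m := F.m) (K := J) (j := 0) (m' := F.m) (K' := J + (t + 1)) (j' := t + 1) (by omega)) B).tgt) ∧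
                ∀ ν, (B10Eq27TorusAxialLog.rel z ℓ'.src ν).natAbs ≤ (2 * F.L + 2)
              then logVec (su2Quat (descendTo F ℰp (J + (t + 1)) K (by omega) (fun ℓ => expPoint (ζ ℓ) * U₀ ℓ : GaugeField (F.P K) 0 (Matrix.specialUnitaryGroup (Fin 2) ℂ)) ℓ' * (descendTo F ℰp (J + (t + 1)) K (by omega) U₀ ℓ')⁻¹)) else 0)‖) ^ 2 := pow_le_pow_left₀ h0 h4 2
      _ = _ := by ring
  have hcov := sum_sq_thickReadSup_le_readSup (F := F) J t (2 * F.L + 2) 3 (by have := F.hL.2; omega)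
    (fun ℓ' : PBond (F.P (J + (t + 1))) 0 => logVec (su2Quat (descendTo F ℰp (J + (t + 1)) K (by omega) (fun ℓ => expPoint (ζ ℓ) * U₀ ℓ : GaugeField (F.P K) 0 (Matrix.specialUnitaryGroup (Fin 2) ℂ)) ℓ' * (descendTo F ℰp (J + (t + 1)) K (by omega) U₀ ℓ')⁻¹)))
  beta_reduce at hcov
  have hC0 : 0 ≤ 256 * Mbar ^ 2 := by positivity
  calc (F.L : ℝ) ^ t * (Cst * ∑ B : PBond (F.P J) 0, ‖(fun p : Plaq (F.P K) (K - (J + (t + 1))) =>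
        if ∃ z₀ : Site (F.P K) 0, (blockIter (K - J) z₀ = (bondShift (F.sitesPerDir_eq (m := F.m) (K := J) (j := 0) (m' := F.m) (K' := K) (j' := K - J) (by omega)) B).src ∨
            blockIter (K - J) z₀ = (bondShift (F.sitesPerDir_eq (m := F.m) (K := J) (j := 0) (m' := F.m) (K' := K) (j' := K - J) (by omega)) B).tgt) ∧
            ∀ κ, (rel (blockIter (K - (J + (t + 1))) z₀) p.src κ).natAbs ≤ 2 * F.L + 1
        then (Real.exp (‖X (K - (J + (t + 1))) ⟨p.src, p.μ⟩‖ + ‖X (K - (J + (t + 1))) ⟨(p.src).shift p.μ, p.ν⟩‖ + ‖X (K - (J + (t + 1))) ⟨(p.src).shift p.ν, p.μ⟩‖ + ‖X (K - (J + (t + 1))) ⟨p.src, p.ν⟩‖) - 1 - (‖X (K - (J + (t + 1))) ⟨p.src, p.μ⟩‖ + ‖X (K - (J + (t + 1))) ⟨(p.src).shift p.μ, p.ν⟩‖ + ‖X (K - (J + (t + 1))) ⟨(p.src).shift p.ν, p.μ⟩‖ + ‖X (K - (J + (t + 1))) ⟨p.src, p.ν⟩‖))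
        else 0)‖ ^ 2)
      ≤ (F.L : ℝ) ^ t * (Cst * ∑ B : PBond (F.P J) 0, 256 * Mbar ^ 2 * ‖(fun ℓ' : PBond (F.P (J + (t + 1))) 0 =>
              if ∃ z : Site (F.P (J + (t + 1))) 0,
                (B14.Eq22Determines.blockIter (t + 1) z = (bondShift (F.sitesPerDir_eq (m := F.m) (K := J) (j := 0) (m' := F.m) (K' := J + (t + 1)) (j' := t + 1) (by omega)) B).src ∨ B14.Eq22Determines.blockIter (t + 1) z = (bondShift (F.sitesPerDir_eq (m := F.m) (K := J) (j := 0) (m' := F.m) (K' := J + (t + 1)) (j' := t + 1) (by omega)) B).tgt) ∧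
                ∀ ν, (B10Eq27TorusAxialLog.rel z ℓ'.src ν).natAbs ≤ (2 * F.L + 2)
              then logVec (su2Quat (descendTo F ℰp (J + (t + 1)) K (by omega) (fun ℓ => expPoint (ζ ℓ) * U₀ ℓ : GaugeField (F.P K) 0 (Matrix.specialUnitaryGroup (Fin 2) ℂ)) ℓ' * (descendTo F ℰp (J + (t + 1)) K (by omega) U₀ ℓ')⁻¹)) else 0)‖ ^ 2) :=
        mul_le_mul_of_nonneg_left (mul_le_mul_of_nonneg_left (Finset.sum_le_sum fun B _ => hsq B) hCst) (pow_nonneg hL0 _)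
    _ = (F.L : ℝ) ^ t * (Cst * (256 * Mbar ^ 2 * ∑ B : PBond (F.P J) 0, ‖(fun ℓ' : PBond (F.P (J + (t + 1))) 0 =>
              if ∃ z : Site (F.P (J + (t + 1))) 0,
                (B14.Eq22Determines.blockIter (t + 1) z = (bondShift (F.sitesPerDir_eq (m := F.m) (K := J) (j := 0) (m' := F.m) (K' := J + (t + 1)) (j' := t + 1) (by omega)) B).src ∨ B14.Eq22Determines.blockIter (t + 1) z = (bondShift (F.sitesPerDir_eq (m := F.m) (K := J) (j := 0) (m' := F.m) (K' := J + (t + 1)) (j' := t + 1) (by omega)) B).tgt) ∧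
                ∀ ν, (B10Eq27TorusAxialLog.rel z ℓ'.src ν).natAbs ≤ (2 * F.L + 2)
              then logVec (su2Quat (descendTo F ℰp (J + (t + 1)) K (by omega) (fun ℓ => expPoint (ζ ℓ) * U₀ ℓ : GaugeField (F.P K) 0 (Matrix.specialUnitaryGroup (Fin 2) ℂ)) ℓ' * (descendTo F ℰp (J + (t + 1)) K (by omega) U₀ ℓ')⁻¹)) else 0)‖ ^ 2)) := by
        rw [← Finset.mul_sum]
    _ ≤ (F.L : ℝ) ^ t * (Cst * (256 * Mbar ^ 2 * (((2 * (F.P J).d * (2 * 3 + 1) ^ (F.P J).d : ℕ) : ℝ) * ∑ B : PBond (F.P J) 0, ‖(fun ℓ' : PBond (F.P (J + (t + 1))) 0 =>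
              if ∃ z : Site (F.P (J + (t + 1))) 0,
                (B14.Eq22Determines.blockIter (t + 1) z = (bondShift (F.sitesPerDir_eq (m := F.m) (K := J) (j := 0) (m' := F.m) (K' := J + (t + 1)) (j' := t + 1) (by omega)) B).src ∨ B14.Eq22Determines.blockIter (t + 1) z = (bondShift (F.sitesPerDir_eq (m := F.m) (K := J) (j := 0) (m' := F.m) (K' := J + (t + 1)) (j' := t + 1) (by omega)) B).tgt) ∧
                ∀ ν, (B10Eq27TorusAxialLog.rel z ℓ'.src ν).natAbs ≤ 2
              then logVec (su2Quat (descendTo F ℰp (J + (t + 1)) K (by omega) (fun ℓ => expPoint (ζ ℓ) * U₀ ℓ : GaugeField (F.P K) 0 (Matrix.specialUnitaryGroup (Fin 2) ℂ)) ℓ' * (descendTo F ℰp (J + (t + 1)) K (by omega) U₀ ℓ')⁻¹)) else 0)‖ ^ 2))) :=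
        mul_le_mul_of_nonneg_left (mul_le_mul_of_nonneg_left (mul_le_mul_of_nonneg_left hcov hC0) hCst) (pow_nonneg hL0 _)
    _ = _ := by ring

end Summit.QuantumFields.YangMills.Theorems.FluctuationComparisonRegPrIntLS2BetaCurlBudgetJunctionShare

end
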